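import Literature.Computability.AlgebraicComplexity.RealTauConjectureDefinable
import Literature.Computability.AlgebraicComplexity.RealTauConjectureDepthFour
import Literature.Computability.AlgebraicComplexity.PochhammerWilkinsonDefinable
import Literature.Computability.Complexity.CountingHierarchyPPoly
import Literature.Computability.Complexity.CircuitEval
import HarnessLib

/-!
# The Koiran–Tavenas transfer theorem from three named facts

Assembly file for the named fact
`Literature.Computability.AlgebraicComplexity.not_isPBounded_constantFreeComplexity_perPoly_of_realTauConjecture`
(`TauConjecture.lean`; Tavenas 2014, Thm. 3.3: the real τ-conjecture implies that `τ(PER_n)` is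
not polynomially bounded). The assembly `…_of` of `RealTauConjectureProofs.lean` takes four
hypotheses — Lemma 3.16, Prop. 3.21, and Bürgisser's Lemmas 2.12 and 2.5(2) — and the companion
files prove three of the four steps feeding them:

* Lemma 3.16 ⇐ Bürgisser's `CH`-definability of the coefficients of `∏ (X - k)`
  (`Tavenas2014_pochhammerWilkinson_definable_of_coeff_chDefinable`,
  `RealTauConjectureDefinable.lean`) ⇐ Bürgisser's Cor. 3.9
  (`Burgisser2009_pochhammerWilkinson_coeff_chDefinable_of_esymm`,
  `PochhammerWilkinsonDefinable.lean`);
* Prop. 3.21 ⇐ Prop. 3.17 and the proved depth-four reduction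
  (`Tavenas2014_prop_3_21_of_prop_3_17`, `RealTauConjectureDepthFour.lean`);
* Lemma 2.5(2) (`PP ⊆ P/poly ⇒ CH ⊆ P/poly`) ⇐ `P/poly ⊆ P/poly-advice`
  (`CH_subset_PPoly_of_PP_subset_PPoly_of`, `CountingHierarchyPPoly.lean`), which is now PROVED
  (`PPoly_subset_polyAdvice_P`, `CircuitEval.lean`: circuit evaluation in polynomial time), so
  that Bürgisser's Lemma 2.5(2) is DISCHARGED here (`CH_subset_PPoly_of_PP_subset_PPoly_holds`).

Hence (`not_isPBounded_constantFreeComplexity_perPoly_of_realTauConjecture_of_facts`) the target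
fact follows from exactly three cited named facts, each a theory of its own:
Bürgisser's Cor. 3.9 (`σ_k(1,…,n)` definable in `CH`: iterated products in the counting hierarchy
via Dlogtime-uniform `TC⁰` division, Hesse–Allender–Barrington), Bürgisser's Lemma 2.12
(`τ(PER) = n^{O(1)} ⇒ PP ⊆ P/poly`: `#P`-completeness of the permanent) and Tavenas' Prop. 3.17
(Valiant's criterion and `VNP`-completeness of the permanent).

## References

* S. Tavenas, *Bornes inférieures et supérieures dans les circuits arithmétiques*, PhD thesis,
  ENS Lyon 2014, Thm. 3.3 and its proof (p. 47), Lemma 3.9, Lemma 3.16, Prop. 3.17, Prop. 3.21.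
* P. Bürgisser, *On defining integers and proving arithmetic circuit lower bounds*, Comput.
  Complexity 18 (2009) 81–103 (= ECCC TR06-113), Lemma 2.5, Lemma 2.12, Cor. 3.9.
* S. Arora, B. Barak, *Computational Complexity* (2009), Thm. 6.18.
-/

namespace Literature.Computability.AlgebraicComplexity

open Complexity

/-- **Discharge of Bürgisser's Lemma 2.5(2)** (`PP ⊆ P/poly ⇒ CH ⊆ P/poly`, the named fact
`CH_subset_PPoly_of_PP_subset_PPoly` of `TauConjectureProofs.lean`): by induction on the levels
(`CountingHierarchyPPoly.CH_subset_PPoly_of_PP_subset_PPoly_of`: a `C·K` witness checker in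
`P/poly` is a `PP`-predicate about a polynomial-time machine with advice) once
`P/poly ⊆ P/poly-advice` (`PPoly_subset_polyAdvice_P`, circuit evaluation in `P`). [cite: Burgisser2006, Lemma 2.5]
-/
theorem CH_subset_PPoly_of_PP_subset_PPoly_holds : CH_subset_PPoly_of_PP_subset_PPoly :=
  CH_subset_PPoly_of_PP_subset_PPoly_of PPoly_subset_polyAdvice_P

/-- **Tavenas' Lemma 3.9 from Bürgisser's Lemma 2.12 alone**: `τ(PER_n) = n^{O(1)}` implies
`CH/poly ⊆ P/poly` (Lemma 2.5(2) being discharged). [cite: Tavenas2014, Lemma 3.9] -/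
theorem polyAdvice_CH_subset_PPoly_of' (h212 : PP_subset_PPoly_of_isPBounded_perPoly)
    (hτ : IsPBounded fun n => constantFreeComplexity (perPoly (Fin n) ℤ)) :
    polyAdvice CH ⊆ PPoly :=
  polyAdvice_CH_subset_PPoly_of h212 CH_subset_PPoly_of_PP_subset_PPoly_holds hτ

/-- **Tavenas' Theorem 3.3 from three named facts** — Bürgisser's Cor. 3.9
(`Burgisser2009_esymm_chDefinable`), Tavenas' Prop. 3.17 (`Tavenas2014_prop_3_17`) and
Bürgisser's Lemma 2.12 (`PP_subset_PPoly_of_isPBounded_perPoly`): everything else in the printed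
proof (Lemma 3.16 from Cor. 3.9, Prop. 3.21 from Prop. 3.17 and the depth-four reduction,
Lemma 3.9 from Lemma 2.12 via `CH ⊆ P/poly` and `(P/poly)/poly ⊆ P/poly`, and the final
root count of `PW_n`) is proved in the tree. [cite: Tavenas2014, Thm. 3.3] -/
theorem not_isPBounded_constantFreeComplexity_perPoly_of_realTauConjecture_of_facts
    (h39 : Burgisser2009_esymm_chDefinable) (h317 : Tavenas2014_prop_3_17)
    (h212 : PP_subset_PPoly_of_isPBounded_perPoly) :
    not_isPBounded_constantFreeComplexity_perPoly_of_realTauConjecture :=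
  not_isPBounded_constantFreeComplexity_perPoly_of_realTauConjecture_of
    (Tavenas2014_pochhammerWilkinson_definable_of_coeff_chDefinable
      (Burgisser2009_pochhammerWilkinson_coeff_chDefinable_of_esymm h39))
    (Tavenas2014_prop_3_21_of_prop_3_17 h317) h212 CH_subset_PPoly_of_PP_subset_PPoly_holds

end Literature.Computability.AlgebraicComplexity
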